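import Summits.AtomisticToContinuum.Crystallization.Theorems.ExcessDecayLiouvillePhononStabilityCertNear

/-!
# Near-certificate layer XI-b: tiered near range (lead c2)

Support file for crux `PhononStability` (stmt-AtomisticToContinuum-9333), line `contragredient-window-collapse`.

The near range `(0, qn]` is split at `qpar`: classes with `Q ≤ qpar` keep the parametric polynomial models of
`nearPPF` (layer XI); the FAR SHELLS `qpar < Q ≤ qn` (attractive, almost constant on a cell) enter with a
CONSTANT checked upper bound `U_c ≥ −ω̃` (`farNum` / `neg_omegaT_le_far` of layer `CertModel`) times the
polynomial longitudinal matrix `ζ̂ζ̂ᵀ` — ten monomials per class instead of a full model expansion.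
`near_le2` is the tiered version of `near_le`.
-/

noncomputable section

open scoped BigOperators Classical InnerProductSpace
open Filter Set Function
open Summit.AtomisticToContinuum.Crystallization.Theorems.PhononStabilityNegative

namespace Summit.AtomisticToContinuum.Crystallization.Theorems.PhononStabilityCWC.Cert

local notation "E3" => EuclideanSpace ℝ (Fin 3)

/-- the far-shell term of a class: `−U · pair(c, ζ̂ζ̂ᵀ)` -/
def farShellTermPPF (C : CellData) (c : BondClass) (U : ℚ) : PolyPF := mulSP [([], -U)] (classPPF c (LmatP C c))

/-- **`farShellPPF`:** the far shells `(qlo, qhi]` with constant bounds `fu c ≥ −ω̃_c` on the cell. -/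
def farShellPPF (C : CellData) (fu : BondClass → ℚ) (qlo qhi : ℤ) : PolyPF :=
  (classRange qlo qhi).flatMap fun c => farShellTermPPF C c (fu c)

/-- the radius of a far shell on the cell: the smaller of the box bound of `Δρ_c` and the window bound `hGeom` -/
def farShellRadius (C : CellData) (hbox : ℕ → ℚ) (c : BondClass) : ℚ :=
  min (spBound (boxList hbox) (spNorm (rhoPoly C c))) (hGeom (Qint c) (C.rhoc c))

/-- the checks of the far-shell bounds on the cell box -/
def farShellChecks (C : CellData) (hbox : ℕ → ℚ) (fu : BondClass → ℚ) (qlo qhi : ℤ) : Bool :=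
  (classRange qlo qhi).all fun c =>
    spListed (boxList hbox) (spNorm (rhoPoly C c)) &&
      nonnegOn (farNum (C.rhoc c) (fu c)) (farShellRadius C hbox c) && decide (Qint c ≠ 36) && decide (36 ≤ Qint c)

/-- **`nearPPF2`:** parametric models on `(0, qpar]`, constant far-shell bounds on `(qpar, qn]`, `κ`-terms. -/
def nearPPF2 (C : CellData) (Hc : Mat) (hbox : ℕ → ℚ) (nd : NearData) (fu : BondClass → ℚ) (qpar qn : ℤ) (κ : ℚ) :
    PolyPF :=
  nearPPF C Hc hbox nd qpar κ ++ farShellPPF C fu qpar qn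

/-- the checks of the tiered near data -/
def nearChecks2 (C : CellData) (hbox : ℕ → ℚ) (nd : NearData) (fu : BondClass → ℚ) (qpar qn : ℤ) : Bool :=
  decide (0 ≤ qpar) && decide (qpar ≤ qn) && nearChecks C hbox nd qpar && farShellChecks C hbox fu qpar qn

/-- splitting a class-range list sum at an intermediate value. [folklore] -/
theorem sum_classRange_split {qlo qmid qhi : ℤ} (h1 : qlo ≤ qmid) (h2 : qmid ≤ qhi) (f : BondClass → ℝ) :
    ((classRange qlo qhi).map f).sum = ((classRange qlo qmid).map f).sum + ((classRange qmid qhi).map f).sum := by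
  rw [← List.sum_toFinset _ (nodup_classRange qlo qhi), ← List.sum_toFinset _ (nodup_classRange qlo qmid),
    ← List.sum_toFinset _ (nodup_classRange qmid qhi), ← Finset.sum_union]
  · congr 1
    ext c
    simp only [Finset.mem_union, List.mem_toFinset]
    constructor
    · intro hc
      obtain ⟨ha, hb⟩ := qint_of_mem_classRange hc
      by_cases hm : Qint c ≤ qmid
      · exact Or.inl (mem_classRange_of_qint ha hm)
      · exact Or.inr (mem_classRange_of_qint (lt_of_not_ge hm) hb)
    · rintro (hc | hc)
      · obtain ⟨ha, hb⟩ := qint_of_mem_classRange hc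
        exact mem_classRange_of_qint ha (hb.trans h2)
      · obtain ⟨ha, hb⟩ := qint_of_mem_classRange hc
        exact mem_classRange_of_qint (lt_of_le_of_lt h1 ha) hb
  · rw [Finset.disjoint_left]
    intro c ha hb
    rw [List.mem_toFinset] at ha hb
    have h3 := (qint_of_mem_classRange ha).2
    have h4 := (qint_of_mem_classRange hb).1
    omega

section Validity

variable (C : CellData) (Hc : Mat) (hbox : ℕ → ℚ) (nd : NearData) (fu : BondClass → ℚ) {A B : E3 →L[ℝ] E3} {δ : E3}
  (hW : CellWindow A) (hδ : ShiftWindow A δ) (hAB : Contragredient A B)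
  (hinv : matEqB (mmul Hc C.G) oneQ = true) (hsym : matEqB (mtrans Hc) Hc = true)
  (hcell : ∀ p ∈ boxList hbox, |chartX C A B δ p.1| ≤ (p.2 : ℝ))
  {w : Label → E3} (hw : (support w).Finite)

include hW hδ hcell hw in
/-- **validity of one far-shell term.** -/
theorem farShellTerm_le {qlo qhi : ℤ} (hlo : 0 ≤ qlo) (hchk : farShellChecks C hbox fu qlo qhi = true) {c : BondClass}
    (hc : c ∈ classRange qlo qhi) :
    evalPPF (farShellTermPPF C c (fu c)) (chartX C A B δ) w ≤ classTerm A B δ w c := by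
  unfold farShellChecks at hchk
  rw [List.all_eq_true] at hchk
  have hcc := hchk c hc
  simp only [Bool.and_eq_true, decide_eq_true_eq] at hcc
  obtain ⟨⟨⟨hlisted, hfar⟩, h36⟩, h36le⟩ := hcc
  have hQpos : 0 < Qint c := lt_of_le_of_lt hlo (qint_of_mem_classRange hc).1
  have hnd : ¬ diagClass c := not_diag_of_qint_pos hQpos
  have hpos : 0 < ‖A (bondVec δ c)‖ := norm_map_bondVec_pos hW hδ hnd
  have hrho := rho_eq chartIdentities C A B δ c
  have hth : |spEval (rhoPoly C c) (chartX C A B δ)| ≤ (farShellRadius C hbox c : ℝ) := by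
    have h1 := abs_spEval_le (boxList hbox) (chartX C A B δ) hcell (spNorm (rhoPoly C c)) hlisted
    rw [spEval_spNorm] at h1
    have h2 := abs_rho_sub_le hW hδ c h36le (C.rhoc c)
    rw [show ‖A (bondVec δ c)‖ ^ 2 - C.rhoc c = spEval (rhoPoly C c) (chartX C A B δ) by linarith] at h2
    unfold farShellRadius
    push_cast
    exact le_min h1 h2
  have hposρ : 0 < (C.rhoc c : ℝ) + spEval (rhoPoly C c) (chartX C A B δ) := by rw [← hrho]; positivity
  have hU := neg_omegaT_le_far hfar hth hposρ
  -- the term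
  unfold farShellTermPPF
  rw [evalPPF_mulSP, evalPPF_classPPF hw, matVal_LmatP, ← longForm_eq_pairEvalR chartIdentities δ c w]
  have hsp : spEval [([], -fu c)] (chartX C A B δ) = -(fu c : ℝ) := by simp [spEval, monoVal]
  rw [hsp]
  unfold classTerm
  have hnn : c ∉ nnClasses := fun h => h36 (qint_eq_36_of_mem_nnClasses h)
  have hψ := psiLJ_nonneg_shell hW hδ hnd hnn
  have hY : 0 ≤ metricForm B c w := tsum_nonneg fun _ => by positivity
  have hψY := mul_nonneg hψ hY
  have hL : 0 ≤ longForm δ c w := by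
    rw [longForm_eq_pairEvalR chartIdentities δ c w]; exact pairEvalR_outer_nonneg c _ w
  have hω : -(fu c : ℝ) ≤ omegaLJ ‖A (bondVec δ c)‖ := by
    rw [omegaLJ_eq_omegaT, hrho]; linarith
  nlinarith

include hW hδ hAB hinv hsym hcell hw in
/-- **VALIDITY OF THE TIERED NEAR RANGE:** `evalPPF nearPPF2 ≤ Σ_{‖ζ⁰‖ ≤ Rn} classTerm − 2κ Σ_nn Y_c`. -/
theorem near_le2 {Rn : ℝ} {bn : ℕ} {qpar qn : ℤ} (hbn : ⌈2 * Rn⌉₊ + 1 = bn) (hqn : ((qn : ℤ) : ℝ) = 36 * Rn ^ 2)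
    (hRn : 0 ≤ Rn) {κ : ℚ} (hκ : 0 ≤ κ) (hchk : nearChecks2 C hbox nd fu qpar qn = true) :
    evalPPF (nearPPF2 C Hc hbox nd fu qpar qn κ) (chartX C A B δ) w ≤
      (∑ c ∈ classesR Rn, classTerm A B δ w c) - 2 * κ * ∑ c ∈ nnClasses, metricForm B c w := by
  unfold nearChecks2 at hchk
  simp only [Bool.and_eq_true, decide_eq_true_eq] at hchk
  obtain ⟨⟨⟨h0, hle⟩, hnear⟩, hfarc⟩ := hchk
  unfold nearPPF2 nearPPF
  rw [evalPPF_append, evalPPF_append, evalPPF_flatMap, evalPPF_flatMap, farShellPPF, evalPPF_flatMap,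
    sum_classesR_eq hbn hqn hRn _ (fun c hc => classTerm_diag A B δ w hc), sum_nnClasses_eq,
    sum_classRange_split h0 hle]
  have h1 : ((classRange 0 qpar).map fun c => evalPPF (nearTermPPF C Hc hbox nd c) (chartX C A B δ) w).sum ≤
      ((classRange 0 qpar).map fun c => classTerm A B δ w c).sum :=
    List.sum_le_sum fun c hc => nearTerm_le C Hc hbox nd hW hδ hAB hinv hsym hcell hw hnear hc
  have h2 : (nnList.map fun c => evalPPF (kappaTermPPF Hc (hsOf hbox) κ c) (chartX C A B δ) w).sum ≤
      (nnList.map fun c => -(2 * (κ : ℝ)) * metricForm B c w).sum :=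
    List.sum_le_sum fun c _ => kappaTerm_le C Hc (hsOf hbox) A B δ c hW hAB hinv hsym (strain_box_of_cell C hbox hcell) hw κ hκ
  have h3 : ((classRange qpar qn).map fun c => evalPPF (farShellTermPPF C c (fu c)) (chartX C A B δ) w).sum ≤
      ((classRange qpar qn).map fun c => classTerm A B δ w c).sum :=
    List.sum_le_sum fun c hc => farShellTerm_le C hbox fu hW hδ hcell hw h0 hfarc hc
  rw [List.sum_map_mul_left] at h2
  linarith

end Validity

/-- Anchor of this support file (registered stub of the line skeleton, lead c2). -/
theorem stub_certNear2 : ∀ (qlo qmid qhi : ℤ), qlo ≤ qmid → qmid ≤ qhi → ∀ f : BondClass → ℝ, ((classRange qlo qhi).map f).sum = ((classRange qlo qmid).map f).sum + ((classRange qmid qhi).map f).sum :=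
  fun _ _ _ h1 h2 f => sum_classRange_split h1 h2 f

end Summit.AtomisticToContinuum.Crystallization.Theorems.PhononStabilityCWC.Cert

end
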